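import Summits.ResolutionOfSingularities.ResolutionOfSingularities.Theorems.EquisingularLiftEquisingularLiftNatRationalCarrierLift
import Literature.AlgebraicGeometry.Resolution.GenusZeroOverCompleteDVR
import Literature.AlgebraicGeometry.Resolution.SpreadRestrict
import HarnessLib

/-!
# [OURS · L1 W4.5(b) · EL♮(3) · residue (T-j)] DISCHARGE of `RationalCarrierLift` at a COMPLETE discrete valuation ring with algebraically
# closed residue field, from the named fact F-102 `GenusZeroOverCompleteDVR` (one application)

Crux chain w45b (cell `res-hironaka`, slot W4.5(b)), working crux **EL♮** = stmt-ResolutionOfSingularities-20038, child **EL♮(3)** =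
stmt-ResolutionOfSingularities-20148, route EquisingularLift, line `sections`; rungs TOWER₃/₄ and NOSE-TOWER₃/₄ (registered stubs
`stub_elnat_coneTowerPointResolution`, `stub_elnat_ratNoseTowerResolution_of_subchainLift₃`). Written by res-L1-type-o6 g30 on res-L1-w45b-plan-1's
DESK 2026-08-27T20:47:50Z «W4.5b (T-j) PACK, (2) (β) the kernel discharge `rationalCarrierLift_of_F_Tj`» (custody RECORD #78b).
HONEST FRAMING: «[OURS · L1 W4.5b · residue (T-j)] replaces the role of nothing printed; NOT a statement of the manuscript»; CONDITIONAL on the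
named fact F-102 (res-dag-4, RESERVED 2026-08-27T20:58:48Z) `Literature.AlgebraicGeometry.Resolution.GenusZeroOverCompleteDVR` taken as the
hypothesis `hF`; AI-written, gate-checked, weaker than expert review. No `sorry`; standard axioms; DEF-FREE.
`--supports stmt-ResolutionOfSingularities-20148 --as helper`.

WHAT. The residue (T-j) of the rational tower — `RationalCarrierLift O k θ P q` / `RationalCarrierLiftAt O k θ X σ q 𝒞`
(`…NatRationalCarrierLift`, p568626): «a proper `O`-flat regular centre `V(𝒞)` whose reduced special fibre `Z̃` is a projective line IS
`ℙ¹_O` over `Spec O`» — FOLLOWS in one application from F-102 whenever `O` is a COMPLETE discrete valuation ring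
(`IsAdicComplete (maximalIdeal O) O`; the chain's choice `O = W(k)`, `stub_wittRing`) with ALGEBRAICALLY CLOSED residue field `k`
(`θ : O →+* k` surjective).  The only glue: the closed fibre of `V(𝒞) → Spec O` is `V(𝒞·𝒪_G)` by pasting Mathlib's cartesian square
`V(𝒞·𝒪_G) → V(𝒞)` over `jG : G → X` (`isPullback_subschemeMap`, Literature `SpreadRestrict`) with the stage's model square
`IsPullback jG tG (σ ≫ q) (Spec θ)`, and `𝒞·𝒪_G = 𝓘⟨Z⟩` (MemberKC (i)) rewrites `RationalCarrier Z̃` into F-102's fibre hypothesis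
(`ProjCech.PP k' 1` is definitionally `(projectiveSpace 1 k').left`).
* `rationalCarrierLiftAt_of_genusZeroOverCompleteDVR` — at one stage/centre;
* `rationalCarrierLift_of_genusZeroOverCompleteDVR` — the ONE assembly binder `(hTj : RationalCarrierLift O k θ P q)` of res-D-pv-029's
  `hsub_reachTower_*` / res-D-pv-018's nose assembly, discharged modulo F-102.
So the tower's (d)/(R4) `hCrat` inputs are CLOSED MODULO F-102 at the top of the chain: birth by this file + `RationalCarrierLiftAt.hCrat(_of_isProper)`,
rounds by `…NatRationalCarrierTransport` (p566897/p567963).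

References (index only): p568626 (`RationalCarrierLift*`), p566897/p567963 (transport), F-102 = `Literature/AlgebraicGeometry/Resolution/GenusZeroOverCompleteDVR.lean`
(EGA IV₄ 17.5.1 / 18.5.17 / relative genus 0 with a section), Literature `SpreadRestrict` (`isPullback_subschemeMap`).
-/

set_option linter.dupNamespace false -- mandated namespace `Summit.<Summit>.<Problem>` of this single-conjunct summit

noncomputable section

open CategoryTheory AlgebraicGeometry TopologicalSpace IsLocalRing
open Literature.AlgebraicGeometry.Resolution
open Literature.AlgebraicGeometry.Morphisms (ProjCech.PP ProjCech.toSpec)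
open AlgebraicGeometry.Scheme.IdealSheafData

namespace Summit.ResolutionOfSingularities.ResolutionOfSingularities.Cruxes.EquisingularLiftNat.Sections

variable {O : Type} [CommRing O] [IsDomain O] [IsDiscreteValuationRing O] [IsAdicComplete (maximalIdeal O) O]
  {k : Type} [Field k] [IsAlgClosed k] {θ : O →+* k} {P : Scheme.{0}} {q : P ⟶ Spec (.of O)}

/-- **Residue (T-j) at ONE centre, from F-102.**  Over a complete discrete valuation ring `O` with algebraically closed residue field
(`θ : O →+* k` surjective), every stage `σ : X ⟶ P` and centre `𝒞` satisfy `RationalCarrierLiftAt O k θ X σ q 𝒞`, given the named fact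
`GenusZeroOverCompleteDVR` (F-102) as the hypothesis `hF`.  [OURS · conditional on F-102] toward `stub_elnat_coneTowerPointResolution` /
`stub_elnat_ratNoseTowerResolution_of_subchainLift₃`; NOT a statement of the manuscript. -/
theorem rationalCarrierLiftAt_of_genusZeroOverCompleteDVR (hF : GenusZeroOverCompleteDVR.{0})
    (hθ : Function.Surjective θ) (X : Scheme.{0}) (σ : X ⟶ P) (𝒞 : X.IdealSheafData) :
    RationalCarrierLiftAt O k θ X σ q 𝒞 := by
  intro G jG tG hsq Z hZ hCD hCproper hCflat hCreg hrat
  -- the closed fibre of `V(𝒞) → Spec O` is `V(𝒞·𝒪_G)`: paste `V(𝒞·𝒪_G) → V(𝒞)` over `jG` with the model square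
  have hsq' : IsPullback (subschemeMap (𝒞.comap jG) 𝒞 jG (𝒞.le_map_comap jG)) ((𝒞.comap jG).subschemeι ≫ tG)
      (𝒞.subschemeι ≫ σ ≫ q) (Spec.map (CommRingCat.ofHom θ)) :=
    (isPullback_subschemeMap jG 𝒞).paste_vert hsq
  -- `𝒞·𝒪_G = 𝓘⟨Z⟩`, so the downstairs certificate is F-102's fibre hypothesis
  have hrat' : ∃ (k' : Type) (_ : Field k'), Nonempty ((𝒞.comap jG).subscheme ≅ ProjCech.PP k' 1) := by
    rw [hCD]; exact hrat
  haveI := hCproper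
  haveI := hCflat
  exact hF O k θ hθ 𝒞.subscheme (𝒞.subschemeι ≫ σ ≫ q) hCreg _ _ _ hsq' hrat'

/-- **Residue (T-j) for the WHOLE tower, from F-102** — the ONE assembly binder `(hTj : RationalCarrierLift O k θ P q)` discharged at a
complete discrete valuation ring with algebraically closed residue field (the chain's `O = W(k)`, `k = k̄`), modulo the named fact
`GenusZeroOverCompleteDVR` (F-102).  [OURS · conditional on F-102] toward `stub_elnat_coneTowerPointResolution` /
`stub_elnat_ratNoseTowerResolution_of_subchainLift₃`; NOT a statement of the manuscript. -/
theorem rationalCarrierLift_of_genusZeroOverCompleteDVR (hF : GenusZeroOverCompleteDVR.{0}) (hθ : Function.Surjective θ) :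
    RationalCarrierLift O k θ P q :=
  fun X σ 𝒞 => rationalCarrierLiftAt_of_genusZeroOverCompleteDVR hF hθ X σ 𝒞

end Summit.ResolutionOfSingularities.ResolutionOfSingularities.Cruxes.EquisingularLiftNat.Sections

end
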